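import Summits.NavierStokesRegularity.NavierStokesRegularity.Theorems.TypeIQuarterGateQuarterLawTypeIUniformLocalTypeI
import Summits.NavierStokesRegularity.NavierStokesRegularity.Theorems.TypeIQuarterGateQuarterLawTypeIWeakL3Count
import Summits.NavierStokesRegularity.NavierStokesRegularity.Theorems.StretchingWellBindingEnstrophyQuarterLawSmoothingEnvelope
import HarnessLib

/-!
# `TypeIQuarterGate`: NEAR-CEILING SPARSITY — the Lorentz Type-I bound is decided by the top
# amplitude octaves below the Type-I ceiling (crux `QuarterLawTypeI`, stmt-NavierStokesRegularity-23726)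

`--supports stmt-NavierStokesRegularity-23726` (helper, def-free).  The registered line `lorentz-upgrade`
of K1 = `QuarterLawTypeI` is at its fixed point (open stub `stub_lorentzUpgrade` = item
`LorentzUpgradeTypeI` 24108: time-Type-I ⟹ `sup_{t<T} sup_λ λ³|{λ < ‖u(t)‖}| < ∞`).  The docstring of
24108 names the enemy: INTERMEDIATE-AMPLITUDE CLOUDS, `|u| ≍ λ ≪ C/√(T−t)` on volume `≫ λ⁻³`.  This file
shows that, along a sup-norm Type-I blow-up, the whole scale-uniform ε-concentration count (hence, by
the tree, the whole weak-`L³` bound at ALL levels and the quarter law) follows from the weak-`L³`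
bound at the levels COMPARABLE TO THE CEILING only:

* `card_mul_le_of_dyadicLevels_concentration` — the tree's weak-`L³` counting lemma
  (`CountQuarterLaw.card_mul_le_of_weakL3_concentration`) with its hypothesis cut down to what its
  proof reads: the level bound `λ_k³ |{λ_k < ‖f‖}| ≤ M'` at the `K+1` DYADIC levels `λ_k = 2^k λ₀`
  below the sup `U ≤ 2^{K+1} λ₀` only.
* `count_of_ceilingSparsity` — NEAR-CEILING SPARSITY ⟹ COUNT: if for every fraction `κ > 0` there are
  `M, t₁ < T` with `(κ/√(T−t))³ · |{x : ‖u(t,x)‖ > κ/√(T−t)}| ≤ M` for `t ∈ [t₁,T)` (the superlevel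
  set at the fraction `κ` of the Type-I amplitude scale fills `O(1)` parabolic cells), then for every
  `η > 0` there are `N, r₀` such that at every scale `r ≤ r₀` a `2r`-separated family of centres whose
  cylinders `B_r(x) × (T−r²,T)` carry `∫∫|∇u|_F² ≥ η r` has at most `N` members.  Mechanism = the
  tree's proof of `CountQuarterLaw.stub_lorentzCount`: Barker–Prange localized smoothing
  (`EnstrophyQuarterLaw.SparseSieve.stub_smoothingEnvelope`) makes every concentrating centre
  `L³`-large on `B(x, 2λr)` at the time `t₀ = T − σλ²r²`, and the dyadic pigeonhole at `t₀` reads the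
  level sets only at the `K+1` levels `2^k κ₀/√(T−t₀)`, `κ₀ = γ√σ/(2(2|B₁|)^{1/3})`, `2^{K+1}κ₀ ≥ B`
  (the Type-I constant) — finitely many FIXED fractions of the ceiling, the same at every scale.

The corollaries BY NAME (`LorentzUpgradeTypeI` ⟺ near-ceiling sparsity, via the tree's
`LorentzOfEnvelope.lorentzBound_of_count`) are in `TypeIQuarterGateLorentzCeilingSparsityByName.lean`.
Reading: an intermediate cloud at level `λ` and time `t` forces, through one-scale smallness, `≳ λ³·vol`
concentrating cylinders at scale `ϑ/λ`, which were already `L³`-large at the EARLIER time at which `λ`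
WAS the ceiling fraction `κ₀`; so the enemy of 24108 is equivalently a NEAR-CEILING CROWD (volume
`≫ (T−t)^{3/2}` above a fixed fraction of the ceiling) at earlier times.

HONEST FRAMING: a-priori statements along a HYPOTHETICAL Type-I blow-up; `LorentzUpgradeTypeI` (24108),
`QuarterLawTypeI` (23726), `UniformConcentrationCountTypeI` (23970) remain OPEN; nothing about
Navier–Stokes regularity or blow-up is claimed and no summit statement is proved.
[cite: BarkerPrange2020, Thm 1] [cite: AlbrittonBarker2019, Lemma 2.6]
-/

noncomputable section

-- the summit-side namespace repeats a component by design (D-0017)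
set_option linter.dupNamespace false

namespace Summit.NavierStokesRegularity.NavierStokesRegularity.Theorems.LorentzCeiling

open Set MeasureTheory Function Metric Filter Topology
open scoped ENNReal NNReal
open Literature.Analysis.FluidPDE
open Summit.NavierStokesRegularity.NavierStokesRegularity.Theorems.CountQuarterLaw

/-! ### The counting lemma with the dyadic-level hypothesis only -/

/-- **Weak-`L³` counting from `K+1` dyadic levels.** Let `f : ℝ³ → ℝ³` be continuous with `‖f‖ ≤ U`,
and suppose the level bound `(2^k λ₀)³ · |{2^k λ₀ < ‖f‖}| ≤ M'` at the dyadic levels `k ≤ K`, where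
`λ₀ > 0`, `λ₀³ ρ³ |B₁| ≤ γ³/2` and `U ≤ 2^{K+1} λ₀`.  Then a `2r`-separated finite family of centres whose
`ρ`-balls carry `γ³ < ∫_{B(x,ρ)} ‖f‖³` has `#σ · γ³/2 ≤ 8 (K+1) ((ρ+r)/r)³ M'`.  (The tree's
`CountQuarterLaw.card_mul_le_of_weakL3_concentration`, hypothesis cut down to the levels its proof reads.)
[folklore] -/
theorem card_mul_le_of_dyadicLevels_concentration
    {f : EuclideanSpace ℝ (Fin 3) → EuclideanSpace ℝ (Fin 3)} (hf : Continuous f)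
    {U M' γ r ρ l0 : ℝ} {K : ℕ} (hM' : 0 ≤ M') (hγ : 0 < γ) (hr : 0 < r) (hρ : 0 < ρ)
    (hl0 : 0 < l0)
    (hbound : ∀ y, ‖f y‖ ≤ U)
    (hweak : ∀ k ∈ Finset.range (K + 1),
      ENNReal.ofReal ((2 ^ k * l0) ^ 3) * volume {y | (2 : ℝ) ^ k * l0 < ‖f y‖} ≤ ENNReal.ofReal M')
    (hl0γ : l0 ^ 3 * (ρ ^ 3 * (volume (ball (0 : EuclideanSpace ℝ (Fin 3)) 1)).toReal) ≤ γ ^ 3 / 2)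
    (hK : U ≤ 2 ^ (K + 1) * l0)
    (σ : Finset (EuclideanSpace ℝ (Fin 3)))
    (hsep : ∀ x ∈ σ, ∀ x' ∈ σ, x ≠ x' → 2 * r ≤ dist x x')
    (hconc : ∀ x ∈ σ, ENNReal.ofReal (γ ^ 3) < ∫⁻ y in ball x ρ, ‖f y‖ₑ ^ (3 : ℕ)) :
    (σ.card : ℝ) * (γ ^ 3 / 2) ≤ 8 * (K + 1) * ((ρ + r) / r) ^ 3 * M' := by
  classical
  -- the dyadic level sets and their weights
  set A : ℕ → Set (EuclideanSpace ℝ (Fin 3)) := fun k => {y | (2 : ℝ) ^ k * l0 < ‖f y‖} with hA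
  have hAopen : ∀ k, IsOpen (A k) := fun k => isOpen_lt continuous_const hf.norm
  have hAmeas : ∀ k, MeasurableSet (A k) := fun k => (hAopen k).measurableSet
  set c : ℕ → ℝ≥0∞ := fun k => ENNReal.ofReal (8 * (2 ^ k * l0) ^ 3) with hc
  set g : ℕ → EuclideanSpace ℝ (Fin 3) → ℝ≥0∞ := fun k => (A k).indicator fun _ => c k with hg
  have hgmeas : ∀ k, Measurable (g k) := fun k => measurable_const.indicator (hAmeas k)
  -- pointwise dyadic layer cake in `ℝ≥0∞`
  have hpt : ∀ y, ‖f y‖ₑ ^ (3 : ℕ) ≤ ENNReal.ofReal (l0 ^ 3) + ∑ k ∈ Finset.range (K + 1), g k y := by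
    intro y
    have hreal := pow_three_le_dyadic l0 hl0 K ‖f y‖ (norm_nonneg _) ((hbound y).trans hK)
    have hsum : ∑ k ∈ Finset.range (K + 1), g k y = ENNReal.ofReal (∑ k ∈ Finset.range (K + 1),
        (if 2 ^ k * l0 < ‖f y‖ then 8 * (2 ^ k * l0) ^ 3 else 0)) := by
      rw [ENNReal.ofReal_sum_of_nonneg (fun k _ => by split_ifs <;> positivity)]
      refine Finset.sum_congr rfl fun k _ => ?_
      simp only [hg, hc, Set.indicator_apply, hA, mem_setOf_eq]
      split_ifs <;> simp
    rw [hsum, ← ENNReal.ofReal_add (by positivity) (Finset.sum_nonneg fun k _ => by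
      split_ifs <;> positivity), ← ofReal_norm, ← ENNReal.ofReal_pow (norm_nonneg _)]
    exact ENNReal.ofReal_le_ofReal hreal
  -- integrate over one ball
  have hvolB : ∀ x : EuclideanSpace ℝ (Fin 3), volume (ball x ρ) =
      ENNReal.ofReal (ρ ^ 3 * (volume (ball (0 : EuclideanSpace ℝ (Fin 3)) 1)).toReal) := by
    intro x
    rw [Measure.addHaar_ball volume x hρ.le, finrank_euclideanSpace_fin,
      ENNReal.ofReal_mul (pow_nonneg hρ.le 3), ENNReal.ofReal_toReal measure_ball_lt_top.ne]
  have hball : ∀ x : EuclideanSpace ℝ (Fin 3), ∫⁻ y in ball x ρ, ‖f y‖ₑ ^ (3 : ℕ) ≤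
      ENNReal.ofReal (γ ^ 3 / 2) + ∑ k ∈ Finset.range (K + 1), ∫⁻ y in ball x ρ, g k y := by
    intro x
    calc ∫⁻ y in ball x ρ, ‖f y‖ₑ ^ (3 : ℕ)
        ≤ ∫⁻ y in ball x ρ, (ENNReal.ofReal (l0 ^ 3) + ∑ k ∈ Finset.range (K + 1), g k y) :=
          lintegral_mono fun y => hpt y
      _ = ENNReal.ofReal (l0 ^ 3) * volume (ball x ρ) +
            ∑ k ∈ Finset.range (K + 1), ∫⁻ y in ball x ρ, g k y := by
          rw [lintegral_add_left measurable_const, setLIntegral_const,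
            lintegral_finsetSum _ fun k _ => hgmeas k]
      _ ≤ ENNReal.ofReal (γ ^ 3 / 2) + ∑ k ∈ Finset.range (K + 1), ∫⁻ y in ball x ρ, g k y := by
          refine add_le_add ?_ le_rfl
          rw [hvolB x, ← ENNReal.ofReal_mul (by positivity)]
          exact ENNReal.ofReal_le_ofReal hl0γ
  -- sum over the family; bounded overlap level by level; the level bound at the dyadic levels
  set O : ℝ := ((ρ + 2 * r / 2) / (2 * r / 2)) ^ 3 with hO
  have hO' : O = ((ρ + r) / r) ^ 3 := by rw [hO]; congr 1; field_simp
  have hover : ∀ k, ∑ x ∈ σ, ∫⁻ y in ball x ρ, g k y ≤ ENNReal.ofReal O * (c k * volume (A k)) := by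
    intro k
    have h := EnstrophyQuarterLaw.SparsenessTools.sum_setLIntegral_ball_le_of_separated (s := 2 * r)
      (by positivity) hρ σ hsep (hgmeas k).aemeasurable
    refine h.trans (le_of_eq ?_)
    rw [hg, lintegral_indicator_const (hAmeas k)]
  have hlevel : ∀ k ∈ Finset.range (K + 1), c k * volume (A k) ≤ 8 * ENNReal.ofReal M' := by
    intro k hk
    calc c k * volume (A k) = 8 * (ENNReal.ofReal ((2 ^ k * l0) ^ 3) * volume (A k)) := by
          rw [hc]
          simp only
          rw [ENNReal.ofReal_mul (by norm_num), ENNReal.ofReal_ofNat, mul_assoc]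
      _ ≤ 8 * ENNReal.ofReal M' := mul_le_mul' le_rfl (hweak k hk)
  -- the chain
  have hchain : (σ.card : ℝ≥0∞) * ENNReal.ofReal (γ ^ 3) ≤
      (σ.card : ℝ≥0∞) * ENNReal.ofReal (γ ^ 3 / 2) +
        (K + 1 : ℕ) * (ENNReal.ofReal O * (8 * ENNReal.ofReal M')) := by
    calc (σ.card : ℝ≥0∞) * ENNReal.ofReal (γ ^ 3)
        = ∑ x ∈ σ, ENNReal.ofReal (γ ^ 3) := by rw [Finset.sum_const, nsmul_eq_mul]
      _ ≤ ∑ x ∈ σ, ∫⁻ y in ball x ρ, ‖f y‖ₑ ^ (3 : ℕ) := Finset.sum_le_sum fun x hx => (hconc x hx).le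
      _ ≤ ∑ x ∈ σ, (ENNReal.ofReal (γ ^ 3 / 2) + ∑ k ∈ Finset.range (K + 1), ∫⁻ y in ball x ρ, g k y) :=
          Finset.sum_le_sum fun x _ => hball x
      _ = (σ.card : ℝ≥0∞) * ENNReal.ofReal (γ ^ 3 / 2) +
            ∑ k ∈ Finset.range (K + 1), ∑ x ∈ σ, ∫⁻ y in ball x ρ, g k y := by
          rw [Finset.sum_add_distrib, Finset.sum_const, nsmul_eq_mul, Finset.sum_comm]
      _ ≤ (σ.card : ℝ≥0∞) * ENNReal.ofReal (γ ^ 3 / 2) +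
            ∑ k ∈ Finset.range (K + 1), ENNReal.ofReal O * (8 * ENNReal.ofReal M') := by
          refine add_le_add le_rfl (Finset.sum_le_sum fun k hk => ?_)
          exact (hover k).trans (mul_le_mul' le_rfl (hlevel k hk))
      _ = _ := by rw [Finset.sum_const, Finset.card_range, nsmul_eq_mul]
  -- pass to `ℝ`
  have hO0 : 0 ≤ O := by rw [hO]; positivity
  have e1 : (σ.card : ℝ≥0∞) * ENNReal.ofReal (γ ^ 3) = ENNReal.ofReal (σ.card * γ ^ 3) := by
    rw [ENNReal.ofReal_mul (Nat.cast_nonneg _), ENNReal.ofReal_natCast]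
  have e2 : (σ.card : ℝ≥0∞) * ENNReal.ofReal (γ ^ 3 / 2) +
      (K + 1 : ℕ) * (ENNReal.ofReal O * (8 * ENNReal.ofReal M')) =
      ENNReal.ofReal (σ.card * (γ ^ 3 / 2) + (K + 1 : ℕ) * (O * (8 * M'))) := by
    rw [ENNReal.ofReal_add (by positivity) (by positivity), ENNReal.ofReal_mul (Nat.cast_nonneg _),
      ENNReal.ofReal_natCast, ENNReal.ofReal_mul (Nat.cast_nonneg _), ENNReal.ofReal_natCast,
      ENNReal.ofReal_mul hO0, ENNReal.ofReal_mul (by norm_num), ENNReal.ofReal_ofNat]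
  rw [e1, e2, ENNReal.ofReal_le_ofReal_iff (by positivity)] at hchain
  rw [← hO']
  push_cast at hchain
  nlinarith [hchain, hO0, hM']

/-! ### Near-ceiling sparsity ⟹ the scale-uniform ε-concentration count -/

set_option maxHeartbeats 800000 in
/-- **Near-ceiling sparsity ⟹ scale-uniform ε-concentration count.**  Along a maximal classical
Leray–Hopf solution from a rapidly decaying datum with the sup-norm Type-I rate at `T`: if for every
fraction `κ > 0` there are `M` and `t₁ < T` with `(κ/√(T−t))³ · |{x : κ/√(T−t) < ‖u(t,x)‖}| ≤ M` for
all `t ∈ [t₁,T)`, then for every `η > 0` there are `N, r₀` such that at every scale `r ≤ r₀` a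
`2r`-separated family of centres whose cylinders `B_r(x) × (T−r²,T)` carry `∫∫|∇u|_F² ≥ η r` has at
most `N` members. [cite: BarkerPrange2020, Thm 1] -/
theorem count_of_ceilingSparsity {ν T : ℝ} (hν : 0 < ν) (hT : 0 < T)
    {u : ℝ → EuclideanSpace ℝ (Fin 3) → EuclideanSpace ℝ (Fin 3)}
    {p : ℝ → EuclideanSpace ℝ (Fin 3) → ℝ}
    (hmax : IsMaximalSmoothSolution ν 0 u p T) (hLH : IsLerayHopfOn T ν 0 (u 0) u)
    (hdec : HasRapidSpatialDecay (u 0)) (hI : IsTypeIBlowup u T)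
    (hceil : ∀ κ : ℝ, 0 < κ → ∃ M t₁ : ℝ, t₁ < T ∧ ∀ t ∈ Ico t₁ T,
      ENNReal.ofReal ((κ / Real.sqrt (T - t)) ^ 3) *
        volume {x | κ / Real.sqrt (T - t) < ‖u t x‖} ≤ ENNReal.ofReal M) :
    ∀ η : ℝ, 0 < η → ∃ N : ℕ, ∃ r₀ : ℝ, 0 < r₀ ∧ ∀ r : ℝ, 0 < r → r ≤ r₀ →
      ∀ σ : Finset (EuclideanSpace ℝ (Fin 3)),
        (∀ x ∈ σ, ∀ x' ∈ σ, x ≠ x' → 2 * r ≤ ‖x - x'‖) →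
        (∀ x ∈ σ, ENNReal.ofReal (η * r) ≤ ∫⁻ s in Ioo (T - r ^ 2) T, ∫⁻ y in ball x r,
          ENNReal.ofReal (frobeniusNormSq (fderiv ℝ (u s) y))) → σ.card ≤ N := by
  intro η hη
  classical
  have hsol : IsClassicalNSSolutionOn (Ico 0 T) ν 0 u p := hmax.1
  -- 1. uniform local energy (Type I)
  obtain ⟨Ml, r₀, hMl, hr₀, hA, -⟩ := uniformLocalTypeI_of_isTypeIBlowup hν hT hsol hLH hdec hI
  -- 2. the smoothing envelope
  obtain ⟨γ, σs, C, hγ, hσs, hC, hsmooth⟩ :=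
    EnstrophyQuarterLaw.SparseSieve.stub_smoothingEnvelope ν T hν hT u p hmax hLH hdec Ml r₀ hMl hr₀ hA
  -- the Type-I rate with a non-negative constant
  obtain ⟨CI, hCI⟩ := hI
  obtain ⟨tI, htIT, hIsub⟩ := mem_nhdsLT_iff_exists_Ioo_subset.1 hCI
  set tI' : ℝ := max tI 0 with htI'
  have htI'T : tI' < T := max_lt htIT hT
  have htI'0 : 0 ≤ tI' := le_max_right _ _
  set B : ℝ := max CI 0 with hB
  have hB0 : 0 ≤ B := le_max_right _ _
  have hrate : ∀ s ∈ Ioo tI' T, ∀ y, ‖u s y‖ ≤ B / Real.sqrt (T - s) := fun s hs y =>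
    (hIsub ⟨lt_of_le_of_lt (le_max_left _ _) hs.1, hs.2⟩ y).trans
      (div_le_div_of_nonneg_right (le_max_left _ _) (Real.sqrt_nonneg _))
  -- the unit-ball volume and the cube root constant
  set V₁ : ℝ := (volume (ball (0 : EuclideanSpace ℝ (Fin 3)) 1)).toReal with hV₁
  have hV₁pos : 0 < V₁ :=
    ENNReal.toReal_pos (measure_ball_pos volume _ one_pos).ne' measure_ball_lt_top.ne
  set cV : ℝ := (2 * V₁) ^ (1 / 3 : ℝ) with hcV
  have hcVpos : 0 < cV := Real.rpow_pos_of_pos (by positivity) _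
  have hcV3 : cV ^ 3 = 2 * V₁ := by
    rw [hcV, ← Real.rpow_natCast, ← Real.rpow_mul (by positivity)]
    norm_num
  -- the scale factor `λ`
  set lam : ℝ := max 4 (max (2 / Real.sqrt σs) (3 * C / η + 1)) with hlam
  have hlam4 : 4 ≤ lam := le_max_left _ _
  have hlampos : 0 < lam := lt_of_lt_of_le (by norm_num) hlam4
  have hlamσ : 2 / Real.sqrt σs ≤ lam := (le_max_left _ _).trans (le_max_right _ _)
  have hlamC : 3 * C / η + 1 ≤ lam := (le_max_right _ _).trans (le_max_right _ _)
  have hsqσ : 0 < Real.sqrt σs := Real.sqrt_pos.2 hσs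
  have hσlam : 4 ≤ σs * lam ^ 2 := by
    have h1 : 2 ≤ Real.sqrt σs * lam := by
      have := mul_le_mul_of_nonneg_left hlamσ hsqσ.le
      rwa [mul_div_cancel₀ _ hsqσ.ne'] at this
    have h2 := pow_le_pow_left₀ (by norm_num) h1 2
    rw [mul_pow, Real.sq_sqrt hσs.le] at h2
    linarith
  have hηlam : 3 * C < η * lam := by
    have h1 : η * (3 * C / η + 1) ≤ η * lam := mul_le_mul_of_nonneg_left hlamC hη.le
    rw [mul_add, mul_div_cancel₀ _ hη.ne', mul_one] at h1
    linarith
  -- the number of dyadic levels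
  set Q : ℝ := 2 * B * cV / (Real.sqrt σs * γ) with hQ
  have hQ0 : 0 ≤ Q := by rw [hQ]; positivity
  set K : ℕ := ⌈Q⌉₊ with hK
  have hQK : Q ≤ 2 ^ (K + 1) := by
    have h1 : Q ≤ K := Nat.le_ceil Q
    have h2 : (K : ℝ) < 2 ^ K := by exact_mod_cast Nat.lt_two_pow_self
    have h3 : (2 : ℝ) ^ K ≤ 2 ^ (K + 1) := pow_le_pow_right₀ (by norm_num) (Nat.le_succ _)
    linarith
  -- the FIXED ceiling fractions `2^k κ₀`, `k ≤ K`, and their sparsity constants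
  set κ₀ : ℝ := γ * Real.sqrt σs / (2 * cV) with hκ₀
  have hκ₀pos : 0 < κ₀ := by rw [hκ₀]; positivity
  choose Mf tf htf hMf using fun k : ℕ => hceil (2 ^ k * κ₀) (by positivity)
  set M'' : ℝ := ∑ k ∈ Finset.range (K + 1), max (Mf k) 0 with hM''
  have hM''0 : 0 ≤ M'' := Finset.sum_nonneg fun k _ => le_max_right _ _
  have hMk : ∀ k ∈ Finset.range (K + 1), Mf k ≤ M'' := fun k hk =>
    (le_max_left _ _).trans (Finset.single_le_sum (fun j _ => le_max_right (Mf j) 0) hk)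
  have hne : (Finset.range (K + 1)).Nonempty := ⟨0, by simp⟩
  set tstar : ℝ := (Finset.range (K + 1)).sup' hne tf with htstar
  have htstarT : tstar < T := (Finset.sup'_lt_iff hne).2 fun k _ => htf k
  have htk : ∀ k ∈ Finset.range (K + 1), tf k ≤ tstar := fun k hk => Finset.le_sup' tf hk
  -- the bound `N` and the admissible scales
  set N : ℕ := ⌈16 * (K + 1) * (2 * lam + 1) ^ 3 * M'' / γ ^ 3⌉₊ with hN
  have hσl : 0 < σs * lam ^ 2 := by positivity
  -- (b) the consumed time lies past the onset of the rate AND past `t⋆`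
  set T₁ : ℝ := max tI' tstar with hT₁
  have hT₁T : T₁ < T := max_lt htI'T htstarT
  set rb : ℝ := Real.sqrt ((T - T₁) / (4 * (σs * lam ^ 2))) with hrb
  have hbden : 0 < 4 * (σs * lam ^ 2) := by positivity
  have hrbpos : 0 < rb := by rw [hrb]; exact Real.sqrt_pos.2 (div_pos (by linarith) hbden)
  have hrbsq : ∀ r : ℝ, 0 < r → r ≤ rb → σs * lam ^ 2 * r ^ 2 ≤ (T - T₁) / 4 := by
    intro r hr hrle
    have h1 : r ^ 2 ≤ rb ^ 2 := pow_le_pow_left₀ hr.le hrle 2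
    have h2 : rb ^ 2 = (T - T₁) / (4 * (σs * lam ^ 2)) := by
      rw [hrb, Real.sq_sqrt (div_pos (by linarith) hbden).le]
    rw [h2] at h1
    have h3 := mul_le_mul_of_nonneg_left h1 hσl.le
    rw [show σs * lam ^ 2 * ((T - T₁) / (4 * (σs * lam ^ 2))) = (T - T₁) / 4 by
      field_simp] at h3
    exact h3
  set r₁ : ℝ := min (r₀ / lam) rb with hr₁
  have hr₁pos : 0 < r₁ := lt_min (div_pos hr₀ hlampos) hrbpos
  refine ⟨N, r₁, hr₁pos, ?_⟩
  intro r hr hrr₁ σ hsep hconc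
  have hRr₀ : lam * r ≤ r₀ := by
    have h1 : r ≤ r₀ / lam := hrr₁.trans (min_le_left _ _)
    have := mul_le_mul_of_nonneg_left h1 hlampos.le
    rwa [mul_div_cancel₀ _ hlampos.ne'] at this
  have hrb' : σs * lam ^ 2 * r ^ 2 ≤ (T - T₁) / 4 := hrbsq r hr (hrr₁.trans (min_le_right _ _))
  set R : ℝ := lam * r with hR
  have hRpos : 0 < R := mul_pos hlampos hr
  set t₀ : ℝ := T - σs * R ^ 2 with ht₀
  have hσR : σs * R ^ 2 = σs * lam ^ 2 * r ^ 2 := by rw [hR]; ring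
  have ht₀T₁ : T₁ < t₀ := by rw [ht₀, hσR]; linarith
  have ht₀I : tI' < t₀ := lt_of_le_of_lt (le_max_left _ _) ht₀T₁
  have ht₀star : tstar < t₀ := lt_of_le_of_lt (le_max_right _ _) ht₀T₁
  have ht₀T : t₀ < T := by rw [ht₀]; linarith [mul_pos hσs (pow_pos hRpos 2)]
  have ht₀0 : 0 ≤ t₀ := htI'0.trans ht₀I.le
  have hTt₀ : T - t₀ = σs * lam ^ 2 * r ^ 2 := by rw [ht₀, hσR]; ring
  -- 2'. every concentrating centre is NOT small at time `t₀` on `B(x, 2R)`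
  have hbig : ∀ x ∈ σ, ENNReal.ofReal (γ ^ 3) < ∫⁻ y in ball x (2 * R), ‖u t₀ y‖ₑ ^ (3 : ℕ) := by
    intro x hx
    by_contra hsmall
    rw [not_lt] at hsmall
    have ht₁ : T - r ^ 2 ∈ Ico (T - σs * R ^ 2 / 4) T := by
      refine ⟨?_, by nlinarith [hr]⟩
      rw [hσR]
      nlinarith [hσlam, pow_pos hr 2]
    have henv := hsmooth T R x hRpos hRr₀ (by rw [← ht₀]; exact ht₀0) le_rfl
      (by rw [← ht₀]; exact hsmall) (T - r ^ 2) ht₁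
    rw [sub_sub_cancel] at henv
    have h3 : ∫⁻ s in Ioo (T - r ^ 2) T, ∫⁻ y in ball x r,
        ENNReal.ofReal (frobeniusNormSq (fderiv ℝ (u s) y)) ≤
        3 * ∫⁻ s in Ioo (T - r ^ 2) T, ∫⁻ y in ball x (R / 4), ‖fderiv ℝ (u s) y‖ₑ ^ 2 := by
      rw [← lintegral_const_mul' _ _ (by norm_num)]
      refine lintegral_mono fun s => ?_
      rw [← lintegral_const_mul' _ _ (by norm_num)]
      have hsub : ball x r ⊆ ball x (R / 4) := by
        refine ball_subset_ball ?_
        have : 4 * r ≤ lam * r := mul_le_mul_of_nonneg_right hlam4 hr.le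
        rw [hR]; linarith
      refine (lintegral_mono_set hsub).trans (lintegral_mono fun y => ?_)
      calc ENNReal.ofReal (frobeniusNormSq (fderiv ℝ (u s) y))
          ≤ ENNReal.ofReal (3 * ‖fderiv ℝ (u s) y‖ ^ 2) :=
            ENNReal.ofReal_le_ofReal (frobeniusNormSq_le_three_mul _)
        _ = 3 * ‖fderiv ℝ (u s) y‖ₑ ^ 2 := by
            rw [ENNReal.ofReal_mul (by norm_num), ENNReal.ofReal_ofNat,
              ENNReal.ofReal_pow (norm_nonneg _), ofReal_norm]
    have h4 : ENNReal.ofReal (η * r) ≤ ENNReal.ofReal (3 * (C * r ^ 2 / R)) := by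
      refine ((hconc x hx).trans h3).trans ?_
      rw [ENNReal.ofReal_mul (by norm_num : (0:ℝ) ≤ 3), ENNReal.ofReal_ofNat]
      exact mul_le_mul' le_rfl henv
    rw [ENNReal.ofReal_le_ofReal_iff (by positivity)] at h4
    have e : 3 * (C * r ^ 2 / R) = (3 * C / lam) * r := by
      rw [hR, pow_two, ← mul_assoc, mul_div_mul_right _ _ hr.ne']
      ring
    rw [e] at h4
    have h5 : η ≤ 3 * C / lam := le_of_mul_le_mul_right h4 hr
    rw [le_div_iff₀ hlampos] at h5
    linarith
  -- 3. counting at time `t₀` with the `K+1` ceiling fractions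
  have ht₀Ico : t₀ ∈ Ico 0 T := ⟨ht₀0, ht₀T⟩
  have hcont : Continuous (u t₀) := (hsol.contDiff_velocity ht₀Ico).continuous
  set l0 : ℝ := γ / (2 * R * cV) with hl0
  have hl0pos : 0 < l0 := by rw [hl0]; positivity
  have hl0γ : l0 ^ 3 * ((2 * R) ^ 3 * V₁) = γ ^ 3 / 2 := by
    rw [hl0, div_pow, mul_pow, mul_pow, hcV3]
    field_simp
  set U : ℝ := Q * l0 with hU
  have hsqrt : Real.sqrt (T - t₀) = Real.sqrt σs * lam * r := by
    rw [hTt₀, show σs * lam ^ 2 * r ^ 2 = σs * (lam * r) ^ 2 by ring, Real.sqrt_mul hσs.le,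
      Real.sqrt_sq (mul_pos hlampos hr).le, mul_assoc]
  have hsqrtpos : 0 < Real.sqrt (T - t₀) := Real.sqrt_pos.2 (by linarith)
  have hUeq : B / Real.sqrt (T - t₀) = U := by
    rw [hsqrt, hU, hQ, hl0, hR]
    field_simp
  have hl0eq : κ₀ / Real.sqrt (T - t₀) = l0 := by
    rw [hsqrt, hκ₀, hl0, hR]
    field_simp
  have hbound : ∀ y, ‖u t₀ y‖ ≤ U := fun y => (hrate t₀ ⟨ht₀I, ht₀T⟩ y).trans hUeq.le
  have hKU : U ≤ 2 ^ (K + 1) * l0 := by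
    rw [hU]; exact mul_le_mul_of_nonneg_right hQK hl0pos.le
  have hwk : ∀ k ∈ Finset.range (K + 1),
      ENNReal.ofReal ((2 ^ k * l0) ^ 3) * volume {y | (2 : ℝ) ^ k * l0 < ‖u t₀ y‖} ≤
        ENNReal.ofReal M'' := by
    intro k hk
    have hlev : 2 ^ k * κ₀ / Real.sqrt (T - t₀) = 2 ^ k * l0 := by rw [mul_div_assoc, hl0eq]
    have h := hMf k t₀ ⟨(htk k hk).trans ht₀star.le, ht₀T⟩
    rw [hlev] at h
    exact h.trans (ENNReal.ofReal_le_ofReal (hMk k hk))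
  have hsep' : ∀ x ∈ σ, ∀ x' ∈ σ, x ≠ x' → 2 * r ≤ dist x x' := by
    intro x hx x' hx' hne'; rw [dist_eq_norm]; exact hsep x hx x' hx' hne'
  have hcount := card_mul_le_of_dyadicLevels_concentration hcont hM''0 hγ hr
    (by positivity : (0:ℝ) < 2 * R) hl0pos hbound hwk hl0γ.le hKU σ hsep' hbig
  have e : (2 * R + r) / r = 2 * lam + 1 := by rw [hR]; field_simp
  rw [e] at hcount
  have hreal : (σ.card : ℝ) ≤ 16 * (K + 1) * (2 * lam + 1) ^ 3 * M'' / γ ^ 3 := by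
    rw [le_div_iff₀ (pow_pos hγ 3)]
    calc (σ.card : ℝ) * γ ^ 3 = 2 * ((σ.card : ℝ) * (γ ^ 3 / 2)) := by ring
      _ ≤ 2 * (8 * (K + 1) * (2 * lam + 1) ^ 3 * M'') := mul_le_mul_of_nonneg_left hcount (by norm_num)
      _ = 16 * (K + 1) * (2 * lam + 1) ^ 3 * M'' := by ring
  have hfinal : (σ.card : ℝ) ≤ (N : ℝ) := hreal.trans (by rw [hN]; exact Nat.le_ceil _)
  exact Nat.cast_le.1 hfinal

end Summit.NavierStokesRegularity.NavierStokesRegularity.Theorems.LorentzCeiling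

end
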